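import Summits.ABC.IUTFork.Joshi.ATS4GaloisGroupEmbeds
import Literature.IUT.HodgeTheaters.InitialThetaData
import Literature.IUT.LogVolume.Corollary22ThetaFieldExists
import Literature.IUT.LogVolume.PrincipalArithmeticDivisors
import Literature.IUT.LogVolume.Corollary22TateInput
import Literature.IUT.LogVolume.Corollary22QParamBaseChange
import Literature.NumberTheory.EllipticCurves.DivisionFieldRamificationSquarefreeProofs
import Literature.NumberTheory.EllipticCurves.LegendreSemistableReductionProofs
import Literature.NumberTheory.EllipticCurves.VariableChangePoints
import Literature.NumberTheory.EllipticCurves.FrobeniusTwist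
import Mathlib.FieldTheory.Galois.Infinite
import HarnessLib

/-!
# The printed theta field `F = F_tpd(√−1, E_λ[3·5])` is NOT Galois over `F_mod` — kernel form of finding F-L5t7-1

Record file (D-0012) of the abc-iut cell, block E (rung LADDER-ABC:A2.E; seat abc-iut-E-t28, slot T-28 = [J-IV] §5.4–5.7,
authors-first companion of the LANDED row J4:Thm5.7.1). TAKES NO SIDE on [IUTchIII] Cor. 3.12, on the claims of K. Joshi, or
on S. Mochizuki's reports on them; CLASSICAL arithmetic of the Legendre family, kernel-checked; typed ≠ proved; NO abc claim.
WHY. [J-IV] (arXiv:2403.10430v2) Thm. 5.7.1, p.53 l.39–45, concludes for the LEGENDRE curve `C_λ` and «`L = L_mod(√−1,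
C_λ[2·3·5])`» that «`C_λ` satisfies Initial Theta Data [J-III §3.1, §3.3]», whose clause (9) ([J-III] arXiv:2401.13508v4 p.28)
is «`L/L_mod` is a Galois extension» (= [IUTchI] Def. 3.1 (b), for [IUTchIV] Thm. 1.10's printed «`F := F_tpd(√−1,
E_{F_tpd}[3·5])`», p.22); the tree's literal reading `ATS4.HasInitialThetaData` (p430905) thus demands `IsGalois (fieldOfModuli
(thetaCurve P F)) F` (E-t6's `ATS3.InitialThetaData.isGalois_fieldOfModuli`). The cell's route finding F-L5t7-1 (abc-iut-L5-t7,
`λ = −2−√3`; informal + numerics) observed that this can FAIL; THIS FILE proves the mechanism in the kernel for any point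
`P = (F_tpd, λ)` with `√−1 ∈ F_tpd`, a `ℚ`-automorphism `σ₀` of `F_tpd` with `σ₀(λ) = λ⁻¹`, `j(λ) ∈ ℚ`, and a finite place
`v ∤ 2·3·5` of `F_tpd` with `ord_v(λ)` positive and odd (witnesses over `ℚ(√−1)` and `¬ ATS4.Thm571` are the sequels).
WHAT IS PROVED (theorems only; no definition, no named fact): §1 `not_isSquare_of_isThetaField` — `λ` is not a square in a
theta field `F ⊆ F̄_tpd` (`E_λ` multiplicative at `v`, tree `legendre_hasMultiplicativeReductionAt_of_valuation_lt_one`; `F ⊆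
F_tpd(E_λ[15])` as `√−1 ∈ F_tpd`, E-t26's `mem_fixingSubgroup_fieldRange_of`; so `e(w|v) ∣ 15` is odd, [IUTchIV] Prop. 1.8 (vii) =
abc-iut-S5's `ramificationIdx_divisionField_dvd_of_squarefree`, against `ord_w(r²)` even, `ord_algebraMap`); §2
`isSquare_of_isGalois` — if `F/ℚ` is Galois then `λ` IS a square in `F` (`σ₀` lifts to `F`, `AlgHom.liftNormal`, and to `T ∈
Aut(F̄_tpd)`, `IsAlgClosure.equivOfEquiv`, normalising `Gal(F̄_tpd/F)`; a nonzero `3`-torsion point of `E_λ` goes to `E_{1/λ}`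
and back by the twisting change of variables `u = s⁻¹`, `s² = λ` (`VariableChange.pointEquiv`); all `15`-torsion being
`Gal(F̄_tpd/F)`-fixed, E-t26's `smul_eq_of_mem_fixingSubgroup_fieldRange`, `s ∈ F` by `InfiniteGalois.fixedField_fixingSubgroup`);
§3 **`not_isGalois_fieldOfModuli_thetaField : ¬ IsGalois (fieldOfModuli (thetaCurve P F)) F`**. No `Cor312*`/`Thm311*` import.
[claim: Joshi2024ATS4, status: disputed] [claim: Mochizuki2012, status: disputed]
-/

noncomputable section

open scoped Classical

open NumberField Field IntermediateField WeierstrassCurve IsDedekindDomain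
open Literature.IUT.LogVolume Literature.IUT.LogVolume.Cor22
open Literature.NumberTheory.DiophantineGeometry.GenEll Literature.NumberTheory.EllipticCurves

namespace Summit.ABC.IUTFork.Joshi.ATS4

/-! ## 1. The ramification obstruction: `λ` is not a square in a theta field -/
section Ramification

variable {P : NFPoint}

/-- `ker ρ̄_{E_λ,15} ≤ ker ρ̄_{E_λ,n}` for `n ∣ 15` (an automorphism fixing `E_λ[15](F̄_tpd)` fixes `E_λ[n]`). [folklore] -/
theorem ker_galoisRepTorsion_fifteen_le {n : ℕ} (hn : (n : ℤ) ∣ 15) :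
    (P.legendreCurve.galoisRepTorsion ((15 : ℕ) : ℤ)).ker ≤ (P.legendreCurve.galoisRepTorsion (n : ℤ)).ker := by
  intro σ hσ
  rw [mem_ker_galoisRepTorsion_iff_forall] at hσ ⊢
  refine fun Q => ?_
  obtain ⟨m, hm⟩ := hn
  have hQ : (n : ℤ) • (Q : geomPoints P.legendreCurve) = 0 :=
    (Submodule.mem_torsionBy_iff (n : ℤ) (Q : geomPoints P.legendreCurve)).mp Q.2
  have hQ15 : ((15 : ℕ) : ℤ) • (Q : geomPoints P.legendreCurve) = 0 := by
    rw [show ((15 : ℕ) : ℤ) = 15 from rfl, hm, mul_comm, mul_smul, hQ, smul_zero]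
  have hmem : (Q : geomPoints P.legendreCurve) ∈ geomTorsion P.legendreCurve ((15 : ℕ) : ℤ) :=
    (Submodule.mem_torsionBy_iff _ _).mpr hQ15
  have h' := congrArg Subtype.val (hσ ⟨_, hmem⟩)
  apply Subtype.ext
  rw [AddSubgroup.torsionBy.coe_smul] at h' ⊢
  exact h'

/-- **If `√−1 ∈ F_tpd`, a theta field `F = F_tpd(√−1, E_λ[15]) ⊆ F̄_tpd` lies inside the `15`-division field**:
`ker ρ̄_{E_λ,15} ≤ Gal(F̄_tpd/F)` (E-t26's `mem_fixingSubgroup_fieldRange_of`: an automorphism fixing `√−1`, `E_λ[3]` and `E_λ[5]`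
fixes the generators of `F`). [cite: Mochizuki2012, IUTchIV Cor. 2.2 (ii) p.42] -/
theorem ker_galoisRepTorsion_le_fixingSubgroup (hi : ∃ i : P.F, i ^ 2 = -1)
    (F : IntermediateField P.F (AlgebraicClosure P.F)) [NumberField F] (hF : IsThetaField P F) :
    (P.legendreCurve.galoisRepTorsion ((15 : ℕ) : ℤ)).ker ≤
      (F.fixingSubgroup : Subgroup (absoluteGaloisGroup P.F)) := by
  intro σ hσ
  obtain ⟨i₀, hi₀⟩ := hi
  have hi' : (algebraMap P.F (AlgebraicClosure P.F) i₀) ^ 2 = -1 := by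
    rw [← map_pow, hi₀, map_neg, map_one]
  have hσi : σ • algebraMap P.F (AlgebraicClosure P.F) i₀ = algebraMap P.F (AlgebraicClosure P.F) i₀ := by
    rw [absoluteGaloisGroup.smul_def]
    exact AlgEquiv.commutes _ _
  have h := mem_fixingSubgroup_fieldRange_of hF F.val hi' hσi
    (ker_galoisRepTorsion_fifteen_le ⟨5, by norm_num⟩ hσ) (ker_galoisRepTorsion_fifteen_le ⟨3, by norm_num⟩ hσ)
  rwa [fieldRange_val] at h


/-- `15 = 3·5` is squarefree. [folklore] -/
theorem squarefree_fifteen : Squarefree (15 : ℕ) := by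
  rw [show (15 : ℕ) = 3 * 5 by norm_num]
  exact (Nat.squarefree_mul (by norm_num)).2 ⟨Nat.prime_three.squarefree, Nat.prime_five.squarefree⟩

/-- An element of positive `ord_v` has `v`-adic valuation `< 1`. [folklore] -/
theorem valuation_lt_one_of_ord_pos {K : Type} [Field K] [NumberField K] (v : HeightOneSpectrum (𝓞 K))
    {x : K} (hx : x ≠ 0) (h : 0 < ord K v x) : v.valuation K x < 1 := by
  unfold ord at h
  have hvx : v.valuation K x ≠ 0 := (v.valuation K).ne_zero_iff.mpr hx
  rw [neg_pos, ← WithZero.log_one, WithZero.log_lt_log hvx one_ne_zero] at h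
  exact h

/-- **`λ` is not a square in a theta field** when some place `v ∤ 2·3·5` of `F_tpd ∋ √−1` has `ord_v(λ)` positive
and odd: the Legendre curve has multiplicative reduction at `v`, the theta field lies in the `15`-division field,
so every place `w ∣ v` of `F` has ramification index dividing `15` ([IUTchIV] Prop. 1.8 (vii)), hence odd — while
`λ = r²` would make `ord_w(λ) = e(w|v)·ord_v(λ)` even. [folklore] -/
theorem not_isSquare_of_isThetaField (hU : P.InU) (hi : ∃ i : P.F, i ^ 2 = -1)
    (v : HeightOneSpectrum (𝓞 P.F)) (hv2 : v.valuation P.F (2 : P.F) = 1)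
    (hv15 : ((15 : ℕ) : 𝓞 P.F) ∉ v.asIdeal) (hpos : 0 < ord P.F v P.x) (hodd : Odd (ord P.F v P.x))
    (F : IntermediateField P.F (AlgebraicClosure P.F)) [NumberField F] (hF : IsThetaField P F) :
    ¬ IsSquare (algebraMap P.F F P.x) := by
  rintro ⟨r, hr⟩
  haveI hE : P.legendreCurve.IsElliptic := P.legendreCurve_isElliptic_iff.2 hU
  have hx0 : P.x ≠ 0 := hU.1
  -- multiplicative reduction at `v`
  have hval : v.valuation P.F P.x < 1 := valuation_lt_one_of_ord_pos v hx0 hpos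
  have hmult : P.legendreCurve.HasMultiplicativeReductionAt v :=
    legendre_hasMultiplicativeReductionAt_of_valuation_lt_one v hv2 hval
  -- the theta field is finite Galois over `F_tpd` and lies in the `15`-division field
  haveI : IsGalois P.F F := hF.isGalois
  haveI : FiniteDimensional P.F F := Module.Finite.of_restrictScalars_finite ℚ P.F F
  have hker := ker_galoisRepTorsion_le_fixingSubgroup hi F hF
  -- a prime of `F` over `v`
  obtain ⟨Q, hQmax, hQover⟩ :=
    Ideal.exists_maximal_ideal_liesOver_of_isIntegral (S := 𝓞 F) v.asIdeal
  haveI := hQmax.isPrime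
  haveI := hQover
  have hdvd : Q.ramificationIdx (𝓞 P.F) ∣ 15 :=
    ramificationIdx_divisionField_dvd_of_squarefree P.legendreCurve (n := 15) squarefree_fifteen F hker hmult hv15 Q
  have hQne : Q ≠ ⊥ := Ideal.ne_bot_of_liesOver_of_ne_bot v.ne_bot Q
  let w : HeightOneSpectrum (𝓞 F) := ⟨Q, hQmax.isPrime, hQne⟩
  have hbelow : finBelow P.F F w = v := by
    apply HeightOneSpectrum.ext
    show Q.under (𝓞 P.F) = v.asIdeal
    exact hQover.over.symm
  have he : ((finBelow P.F F w).asIdeal.ramificationIdx' w.asIdeal : ℤ) = Q.ramificationIdx (𝓞 P.F) := by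
    rw [hbelow]
    exact_mod_cast Ideal.ramificationIdx'_eq_ramificationIdx v.asIdeal Q v.ne_bot
  -- `ord_w(λ) = e(w|v)·ord_v(λ)` is odd …
  have hord := ord_algebraMap P.F F w P.x
  rw [he, hbelow] at hord
  have hodd' : Odd (ord F w (algebraMap P.F F P.x)) := by
    rw [hord]
    refine Int.odd_mul.mpr ⟨?_, hodd⟩
    have h15 : Odd (15 : ℕ) := by decide
    exact_mod_cast (Odd.of_dvd_nat h15 hdvd)
  -- … but `λ = r·r` has even order
  have hr0 : r ≠ 0 := by
    rintro rfl
    rw [mul_zero] at hr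
    exact hx0 ((map_eq_zero_iff _ (algebraMap P.F F).injective).mp hr)
  have heven : Even (ord F w (algebraMap P.F F P.x)) := by
    rw [hr, ord_mul _ w hr0 hr0]
    exact Even.add_self _
  exact (Int.not_even_iff_odd.mpr hodd') heven

end Ramification

/-! ## 2. The twist argument: if the theta field is Galois over `ℚ`, then `λ` is a square in it -/
section Twist

variable {P : NFPoint}

/-- Transport of a torsion identity along an equality of Weierstrass curves (same coordinates). [folklore] -/
theorem exists_nonsingular_smul_eq_zero_of_eq {Ω : Type} [Field Ω] {V V' : WeierstrassCurve Ω} (hVV' : V = V')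
    {x y : Ω} (hns : V.toAffine.Nonsingular x y) (n : ℤ) (hn : n • Affine.Point.some x y hns = 0) :
    ∃ hns' : V'.toAffine.Nonsingular x y, n • Affine.Point.some x y hns' = 0 := by
  subst hVV'
  exact ⟨hns, hn⟩

/-- A nonzero `3`-torsion point `(x, y)` of `y² = x(x−1)(x−λ)` over `F̄_tpd` exists (`#E[3] = 9`), and has `y ≠ 0` (a point
with `y = 0` is its own negative, hence `2`-torsion). [folklore] -/
theorem exists_three_torsion_coords (hU : P.InU) :
    ∃ (x y : AlgebraicClosure P.F) (h : (P.legendreCurve.baseChange (AlgebraicClosure P.F)).toAffine.Nonsingular x y),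
      (3 : ℤ) • Affine.Point.some x y h = 0 ∧ y ≠ 0 := by
  haveI hE : P.legendreCurve.IsElliptic := P.legendreCurve_isElliptic_iff.2 hU
  let Ω := AlgebraicClosure P.F
  haveI : CharZero Ω := charZero_of_injective_algebraMap (algebraMap P.F Ω).injective
  have hcard : Nat.card (torsionPoints P.legendreCurve Ω ((3 : ℕ) : ℤ)) = 3 ^ 2 :=
    card_torsionPoints_eq_sq_holds P.legendreCurve Ω (by exact_mod_cast (by norm_num : (3 : ℕ) ≠ 0))
  haveI : Finite (torsionPoints P.legendreCurve Ω ((3 : ℕ) : ℤ)) := finite_torsionPoints_holds P.legendreCurve Ω (by norm_num)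
  haveI : Nontrivial (torsionPoints P.legendreCurve Ω ((3 : ℕ) : ℤ)) :=
    (Finite.one_lt_card_iff_nontrivial).1 (by rw [hcard]; norm_num)
  obtain ⟨⟨Q, hQ⟩, hQ0⟩ := exists_ne (0 : torsionPoints P.legendreCurve Ω ((3 : ℕ) : ℤ))
  have hQ3 : (3 : ℤ) • Q = 0 := (Submodule.mem_torsionBy_iff _ _).mp hQ
  rcases Q with _ | ⟨x, y, h⟩
  · exact absurd rfl hQ0
  refine ⟨x, y, h, hQ3, fun hy => hQ0 (Subtype.ext ?_)⟩
  have hneg : -Affine.Point.some x y h = Affine.Point.some x y h := by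
    rw [Affine.Point.neg_some]; congr 1; simp [Affine.negY, hy]
  have h2 : (2 : ℤ) • Affine.Point.some x y h = 0 := by
    rw [two_zsmul]; nth_rewrite 1 [← hneg]; exact neg_add_cancel _
  have key : ((3 : ℤ) - 2) • Affine.Point.some x y h = 0 := by rw [sub_smul, hQ3, h2, sub_zero]
  norm_num at key
  exact key

/-- **Extension of `σ₀ ∈ Aut(F_tpd/ℚ)` to `F̄_tpd`, normalising a theta field that is Galois over `ℚ`**: if `F ⊆ Ω = F̄_tpd`
is Galois over `ℚ`, then `σ₀` lifts to a `ℚ`-automorphism of `F` (normality), which extends to a ring automorphism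
`T` of the algebraic closure `Ω` of `F`; `T` restricts to `σ₀` on `F_tpd` and maps `F` into itself. [folklore] -/
theorem exists_ringEquiv_extending (σ₀ : P.F ≃ₐ[ℚ] P.F) (F : IntermediateField P.F (AlgebraicClosure P.F))
    [NumberField F] [IsGalois ℚ F] :
    ∃ T : AlgebraicClosure P.F ≃+* AlgebraicClosure P.F,
      (∀ x : P.F, T (algebraMap P.F _ x) = algebraMap P.F _ (σ₀ x)) ∧ ∀ f : F, T f ∈ F := by
  let Ω := AlgebraicClosure P.F
  let τ : F →ₐ[ℚ] F := AlgHom.liftNormal (σ₀ : P.F →ₐ[ℚ] P.F) F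
  have hτ : ∀ x : P.F, τ (algebraMap P.F F x) = algebraMap P.F F (σ₀ x) :=
    AlgHom.liftNormal_commutes (σ₀ : P.F →ₐ[ℚ] P.F) F
  let τe : F ≃ₐ[ℚ] F := AlgEquiv.ofBijective τ (Algebra.IsAlgebraic.algHom_bijective τ)
  have hτe : ∀ f : F, τe f = τ f := fun _ => rfl
  haveI : Algebra.IsAlgebraic F Ω := Algebra.IsAlgebraic.tower_top (K := P.F) F
  haveI : IsAlgClosure F Ω := { isAlgClosed := inferInstanceAs (IsAlgClosed Ω), isAlgebraic := inferInstance }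
  let T : Ω ≃+* Ω := IsAlgClosure.equivOfEquiv Ω Ω τe.toRingEquiv
  have hT : ∀ f : F, T (algebraMap F Ω f) = algebraMap F Ω (τe f) := fun f =>
    IsAlgClosure.equivOfEquiv_algebraMap Ω Ω τe.toRingEquiv f
  refine ⟨T, fun x => ?_, fun f => ?_⟩
  · rw [IsScalarTower.algebraMap_apply P.F F Ω x, hT, hτe, hτ, ← IsScalarTower.algebraMap_apply]
  · exact (show T (algebraMap F Ω f) ∈ F by rw [hT]; exact (τe f).2)

/-- **Conjugating `Gal(Ω/F)` by the extension `T`**: for `h ∈ Gal(Ω/F)`, the automorphism `h' = T⁻¹ h T` is again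
`F_tpd`-linear (on `F_tpd` it is `σ₀⁻¹ ∘ id ∘ σ₀`) and fixes `F`. [folklore] -/
theorem exists_conj_fixing (σ₀ : P.F ≃ₐ[ℚ] P.F) (F : IntermediateField P.F (AlgebraicClosure P.F))
    (T : AlgebraicClosure P.F ≃+* AlgebraicClosure P.F)
    (hTK : ∀ x : P.F, T (algebraMap P.F _ x) = algebraMap P.F _ (σ₀ x)) (hTF : ∀ f : F, T f ∈ F)
    (h : AlgebraicClosure P.F ≃ₐ[P.F] AlgebraicClosure P.F) (hh : h ∈ F.fixingSubgroup) :
    ∃ h' : AlgebraicClosure P.F ≃ₐ[P.F] AlgebraicClosure P.F,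
      h' ∈ F.fixingSubgroup ∧ ∀ z, h (T z) = T (h' z) := by
  let Ω := AlgebraicClosure P.F
  have hTK' : ∀ x : P.F, T.symm (algebraMap P.F Ω (σ₀ x)) = algebraMap P.F Ω x := fun x => by
    rw [← hTK, RingEquiv.symm_apply_apply]
  let e : Ω ≃+* Ω := (T.trans h.toRingEquiv).trans T.symm
  have he : ∀ z, e z = T.symm (h (T z)) := fun _ => rfl
  have hcomm : ∀ x : P.F, e (algebraMap P.F Ω x) = algebraMap P.F Ω x := fun x => by
    rw [he, hTK, AlgEquiv.commutes, ← hTK' x]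
  let h' : Ω ≃ₐ[P.F] Ω := AlgEquiv.ofRingEquiv (f := e) hcomm
  have hh' : ∀ z, h' z = T.symm (h (T z)) := fun _ => rfl
  refine ⟨h', ?_, fun z => ?_⟩
  · rw [IntermediateField.mem_fixingSubgroup_iff] at hh ⊢
    intro z hz
    rw [hh', hh (T z) (hTF ⟨z, hz⟩), RingEquiv.symm_apply_apply]
  · rw [hh', RingEquiv.apply_symm_apply]

/-- The coordinates of a `15`-torsion point of `E_λ(Ω)` are fixed by `Gal(Ω/F)` for a theta field `F`
(`IsThetaField.torsion_rational`, transported to `Ω`). [folklore] -/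
theorem coords_fixed_of_mem_fixingSubgroup (F : IntermediateField P.F (AlgebraicClosure P.F)) [NumberField F]
    (hF : IsThetaField P F) (h : AlgebraicClosure P.F ≃ₐ[P.F] AlgebraicClosure P.F) (hh : h ∈ F.fixingSubgroup)
    {x y : AlgebraicClosure P.F} (hns : (P.legendreCurve.baseChange (AlgebraicClosure P.F)).toAffine.Nonsingular x y)
    (h15 : (15 : ℤ) • Affine.Point.some x y hns = 0) : h x = x ∧ h y = y := by
  have hh' : (absoluteGaloisGroup.toAlgEquiv P.F).symm h ∈
      (F.val.fieldRange.fixingSubgroup : Subgroup (absoluteGaloisGroup P.F)) := by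
    rw [fieldRange_val]; exact hh
  have key := smul_eq_of_mem_fixingSubgroup_fieldRange hF F.val hh' (Affine.Point.some x y hns) h15
  have hc := forall_coords_of_smul_eq P _ _ key
  exact ⟨hc x (by simp [pointCoords]), hc y (by simp [pointCoords])⟩

/-- The Legendre curve of `F_tpd` over `Ω`, coefficientwise. [folklore] -/
theorem legendreCurve_baseChange_eq (Ω : Type) [Field Ω] [Algebra P.F Ω] :
    P.legendreCurve.baseChange Ω = ⟨0, -(1 + algebraMap P.F Ω P.x), 0, algebraMap P.F Ω P.x, 0⟩ := by
  ext <;> simp [WeierstrassCurve.baseChange, WeierstrassCurve.map]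

/-- **The twisting change of variables**: for `s² = λ`, the substitution `u = s⁻¹` (`x = λ·x'`, `y = λs·y'`) carries the
Legendre equation of `λ⁻¹` to that of `λ` (`E_{1/λ}` is the quadratic twist of `E_λ` by `λ`). [folklore] -/
theorem variableChange_legendre_twist {Ω : Type} [Field Ω] {lam s : Ω} (hs : s ^ 2 = lam) (hs0 : s ≠ 0) :
    (⟨(Units.mk0 s hs0)⁻¹, 0, 0, 0⟩ : VariableChange Ω) • (⟨0, -(1 + lam⁻¹), 0, lam⁻¹, 0⟩ : WeierstrassCurve Ω)
      = ⟨0, -(1 + lam), 0, lam, 0⟩ := by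
  have hlam0 : lam ≠ 0 := by rw [← hs]; exact pow_ne_zero 2 hs0
  ext
  · simp [variableChange_a₁]
  · simp [variableChange_a₂]
    rw [← hs]; field_simp; ring
  · simp [variableChange_a₃]
  · simp [variableChange_a₄]
    rw [← hs]; field_simp
  · simp [variableChange_a₆]

/-- **If a theta field `F = F_tpd(√−1, E_λ[15]) ⊆ Ω` is Galois over `ℚ` and `λ ↦ λ⁻¹` under some `σ₀ ∈ Aut(F_tpd/ℚ)`, then
`λ` is a square in `F`.** Route (Silverman *AEC* X.§2 twisting, done by hand): extend `σ₀` to `T ∈ Aut(Ω)` normalising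
`Gal(Ω/F)`; a nonzero `3`-torsion point `Q` of `E_λ(Ω)` goes to a `3`-torsion point `T(Q)` of `E_{1/λ}`, whose coordinates
are again `Gal(Ω/F)`-fixed; the change of variables `u = s⁻¹`, `s² = λ`, carries `E_{1/λ}` back to `E_λ` and `T(Q)` to the
`3`-torsion point `(λ·x, λs·y)`; all `15`-torsion of `E_λ(Ω)` being `Gal(Ω/F)`-fixed (`IsThetaField`), `s` is fixed, so
`s ∈ F` by the Galois correspondence for `Ω/F_tpd`. [folklore] -/
theorem isSquare_of_isGalois (hU : P.InU) (σ₀ : P.F ≃ₐ[ℚ] P.F) (hσ₀ : σ₀ P.x = P.x⁻¹)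
    (F : IntermediateField P.F (AlgebraicClosure P.F)) [NumberField F] (hF : IsThetaField P F) [IsGalois ℚ F] :
    IsSquare (algebraMap P.F F P.x) := by
  haveI hE : P.legendreCurve.IsElliptic := P.legendreCurve_isElliptic_iff.2 hU
  obtain ⟨T, hTK, hTF⟩ := exists_ringEquiv_extending σ₀ F
  set lam : AlgebraicClosure P.F := algebraMap P.F (AlgebraicClosure P.F) P.x with hlam
  have hlam0 : lam ≠ 0 := (map_ne_zero _).2 hU.1
  have hTlam : T lam = lam⁻¹ := by rw [hlam, hTK, hσ₀, map_inv₀]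
  -- a nonzero `3`-torsion point `Q = (xQ, yQ)` of `E_λ(Ω)`
  obtain ⟨xQ, yQ, hQns, hQ3, hyQ⟩ := exists_three_torsion_coords hU
  have hQ15 : (15 : ℤ) • Affine.Point.some xQ yQ hQns = 0 := by
    rw [show (15 : ℤ) = 5 * 3 by norm_num, mul_smul, hQ3, zsmul_zero]
  -- its image `T(Q)` on `E_{1/λ}`
  let W' : WeierstrassCurve (AlgebraicClosure P.F) := ⟨0, -(1 + lam⁻¹), 0, lam⁻¹, 0⟩
  have hmap : (P.legendreCurve.baseChange (AlgebraicClosure P.F)).map T.toRingHom = W' := by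
    rw [legendreCurve_baseChange_eq, ← hlam]
    ext <;> simp [W', WeierstrassCurve.map, hTlam]
  let Q' : W'.toAffine.Point := mapPoint T.toRingHom hmap (Affine.Point.some xQ yQ hQns)
  have hQ'3 : (3 : ℤ) • Q' = 0 := by
    show (3 : ℤ) • mapPoint T.toRingHom hmap (Affine.Point.some xQ yQ hQns) = 0
    rw [← map_zsmul, hQ3, map_zero]
  obtain ⟨hQ'ns, hQ'eq⟩ : ∃ hns' : W'.toAffine.Nonsingular (T xQ) (T yQ),
      Q' = Affine.Point.some (T xQ) (T yQ) hns' := ⟨_, mapPoint_some T.toRingHom hmap hQns⟩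
  -- a square root `s` of `λ` in `Ω` and the change of variables `u = s⁻¹` from `E_{1/λ}` to `E_λ`
  obtain ⟨s, hs⟩ := IsAlgClosed.exists_pow_nat_eq lam two_pos
  have hs0 : s ≠ 0 := by rintro rfl; exact hlam0 (by rw [← hs]; ring)
  let C : VariableChange (AlgebraicClosure P.F) := ⟨(Units.mk0 s hs0)⁻¹, 0, 0, 0⟩
  have hCu : (↑C.u⁻¹ : AlgebraicClosure P.F) = s := by simp [C]
  have hC : C • W' = P.legendreCurve.baseChange (AlgebraicClosure P.F) := by
    rw [legendreCurve_baseChange_eq, ← hlam]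
    exact variableChange_legendre_twist hs hs0
  let R' := VariableChange.pointEquiv W' C Q'
  have hR'3 : (3 : ℤ) • R' = 0 := by
    show (3 : ℤ) • VariableChange.pointEquiv W' C Q' = 0
    rw [← map_zsmul, hQ'3, map_zero]
  have htoX : C.toX (T xQ) = lam * T xQ := by
    rw [VariableChange.toX_def, hCu, hs]; simp [C]
  have htoY : C.toY (T xQ) (T yQ) = lam * s * T yQ := by
    rw [VariableChange.toY_def, hCu]; simp only [C]; rw [show s ^ 3 = s ^ 2 * s by ring, hs]; ring
  obtain ⟨hR'ns, hR'eq⟩ : ∃ hns' : (C • W').toAffine.Nonsingular (lam * T xQ) (lam * s * T yQ),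
      R' = Affine.Point.some (lam * T xQ) (lam * s * T yQ) hns' := by
    have h := VariableChange.pointEquiv_some W' C hQ'ns
    simp only [htoX, htoY] at h
    exact ⟨_, by rw [show R' = VariableChange.pointEquiv W' C Q' from rfl, hQ'eq, h]⟩
  rw [hR'eq] at hR'3
  obtain ⟨hRns, hR3⟩ := exists_nonsingular_smul_eq_zero_of_eq hC hR'ns 3 hR'3
  have hR15 : (15 : ℤ) • Affine.Point.some (lam * T xQ) (lam * s * T yQ) hRns = 0 := by
    rw [show (15 : ℤ) = 5 * 3 by norm_num, mul_smul, hR3, zsmul_zero]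
  -- every `h ∈ Gal(Ω/F)` fixes `s`
  have hTy0 : T yQ ≠ 0 := fun h0 => hyQ (T.injective (by rw [h0, map_zero]))
  have hsfix : ∀ h ∈ F.fixingSubgroup, h s = s := by
    intro h hh
    obtain ⟨h', hh', hconj⟩ := exists_conj_fixing σ₀ F T hTK hTF h hh
    have hy' : h (T yQ) = T yQ := by
      rw [hconj, (coords_fixed_of_mem_fixingSubgroup F hF h' hh' hQns hQ15).2]
    have hR := (coords_fixed_of_mem_fixingSubgroup F hF h hh hRns hR15).2
    rw [map_mul, map_mul, hy', show h lam = lam from h.commutes P.x] at hR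
    exact mul_right_cancel₀ hTy0 (mul_left_cancel₀ hlam0 (by simpa [mul_assoc] using hR))
  -- hence `s ∈ F` by the Galois correspondence for `Ω/F_tpd`
  haveI : IsGalois P.F (AlgebraicClosure P.F) := {}
  have hsF : s ∈ F := by
    rw [← InfiniteGalois.fixedField_fixingSubgroup F, IntermediateField.mem_fixedField_iff]
    exact hsfix
  refine ⟨⟨s, hsF⟩, ?_⟩
  apply Subtype.val_injective
  change algebraMap F (AlgebraicClosure P.F) (algebraMap P.F F P.x) = s * s
  rw [← IsScalarTower.algebraMap_apply, ← hlam, ← hs]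
  ring

end Twist

/-! ## 3. The theta field of such a point is not Galois over the field of moduli -/
section NonGalois

variable {P : NFPoint}

open Literature.IUT.HodgeTheaters in
/-- If `j(λ) ∈ ℚ`, the field of moduli `ℚ(j(E_F))` of the Legendre curve over any `F ⊇ F_tpd` is the prime field.
[folklore] -/
theorem fieldOfModuli_thetaCurve_eq_bot (hU : P.InU) {q : ℚ} (hq : jInv P.x = q)
    (F : Type) [Field F] [NumberField F] [Algebra P.F F] [(thetaCurve P F).IsElliptic] :
    fieldOfModuli (thetaCurve P F) = ⊥ := by
  unfold fieldOfModuli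
  rw [IntermediateField.adjoin_simple_eq_bot_iff, IntermediateField.mem_bot]
  refine ⟨q, ?_⟩
  have hj : (thetaCurve P F).j = algebraMap P.F F (jInv P.x) :=
    (Cor22.j_legendre (P := extend P F) (extend_inU hU F)
      (hE := inferInstanceAs (thetaCurve P F).IsElliptic)).trans (jInv_map (algebraMap P.F F) P.x).symm
  rw [hj, hq, eq_ratCast, map_ratCast]

open Literature.IUT.HodgeTheaters in
/-- **The printed theta field is not Galois over the field of moduli** at a point `λ ∈ U_X(F_tpd)` such that:
`√−1 ∈ F_tpd`; some `σ₀ ∈ Aut(F_tpd/ℚ)` inverts `λ` (so `j(λ) = j(1/λ)`), and `j(λ) ∈ ℚ`; some place `v ∤ 2·3·5` of `F_tpd`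
has `ord_v(λ)` positive and odd. For every theta field `F = F_tpd(√−1, E_λ[3·5]) ⊆ F̄_tpd` of `λ` (`Cor22.IsThetaField`),
`F/ℚ(j(E_F))` is NOT Galois — so [IUTchI] Def. 3.1 (b) / [J-III] §3.3 (9) «`L/L_mod` Galois» fails for the printed `F`
of [IUTchIV] Thm. 1.10 p. 22 and for Joshi's «`L = L_mod(√−1, C_λ[2·3·5])`», [J-IV] Thm. 5.7.1 (the kernel form of the
cell's finding F-L5t7-1). PROVED: `isSquare_of_isGalois` against `not_isSquare_of_isThetaField`. [folklore] -/
theorem not_isGalois_fieldOfModuli_thetaField (hU : P.InU) (σ₀ : P.F ≃ₐ[ℚ] P.F) (hσ₀ : σ₀ P.x = P.x⁻¹)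
    (hi : ∃ i : P.F, i ^ 2 = -1) {q : ℚ} (hq : jInv P.x = q)
    (v : HeightOneSpectrum (𝓞 P.F)) (hv2 : v.valuation P.F (2 : P.F) = 1) (hv15 : ((15 : ℕ) : 𝓞 P.F) ∉ v.asIdeal)
    (hpos : 0 < ord P.F v P.x) (hodd : Odd (ord P.F v P.x))
    (F : IntermediateField P.F (AlgebraicClosure P.F)) [NumberField F] (hF : IsThetaField P F)
    [(thetaCurve P F).IsElliptic] : ¬ IsGalois (fieldOfModuli (thetaCurve P F)) F := by
  intro hGal
  have key : ∀ S : IntermediateField ℚ F, S = ⊥ → IsGalois S F → IsGalois ℚ F := by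
    rintro S rfl h
    exact isGalois_iff_isGalois_bot.mp h
  haveI : IsGalois ℚ F := key _ (fieldOfModuli_thetaCurve_eq_bot hU hq F) hGal
  exact not_isSquare_of_isThetaField hU hi v hv2 hv15 hpos hodd F hF (isSquare_of_isGalois hU σ₀ hσ₀ F hF)

end NonGalois

end Summit.ABC.IUTFork.Joshi.ATS4

end
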